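import Mathlib
import HarnessLib
import Summits.HubbardSuperconductivity.HubbardSuperconductivity.Theorems.KLProgrammeLatticeSoftBubble

/-!
# Route `KLProgramme` — ENGINE item stmt-HubbardSuperconductivity-20437 `KLRegimeEngineV17F2`, class-#5 STEP (X).3 pinned pair «88b» / located-risk #14 TAIL
# («(X).3-TAIL-WINDOW», direct side): the soft-partner resolution geometry with the WIDE energy shift `|σ| ≤ Λ/6` (was `Λ/8`)
# (cell gate-hubbard-kl, seat hubbard-kl-k3c2-p2 g22)

WHY.  The direct forward window `G|x−y| ≤ Λₙ₊₁/8` of the signed pinned rows is the soft partner's resolution hypothesis `δ_max ≤ Λ/8` (`klfp_sq_ge`: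
`(Λ/2)² < k₀²+e²`, `|q₀| ≤ Λ/8`, `|σ| ≤ Λ/8` ⇒ `(Λ/8)² ≤ (k₀+q₀)²+(e+σ)²`).  The same conclusion holds for `|σ| ≤ Λ/6` (split at `|e| = 7Λ/24`: either
`|e+σ| ≥ 7Λ/24 − Λ/6 = Λ/8`, or `k₀² > Λ²/4 − (7Λ/24)² > (Λ/4)²` and `|k₀+q₀| ≥ Λ/4 − Λ/8`), so the direct window can be the near-form cap `Λ(t)/6` of
`direct_DLine_factors_eq_zero` and the direct edge rows `WDd_edge_row_le_slots` (c a parameter) may take `c = 6` (`32c² = 1152` for `2048`: (T2p) `32855 ↦ ≈18481`).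
* **`klfp_sq_ge_sixth`**, **`klfl_summand_cut_eq_sixth`** (twin of `klfl_summand_cut_eq` with `|e′ − e| ≤ Λ_n/6`).
Pure geometry; nothing about the model is asserted; nothing asserts (X).3, (c), K3 or superconductivity.
-/

noncomputable section

namespace Summit.HubbardSuperconductivity.HubbardSuperconductivity.Theorems.KLRegimeSplit

set_option linter.dupNamespace false -- summit = problem name (single-conjunct summit), D-0017

open Real Set Complex Literature.MathematicalPhysics.QuantumLattice Literature.Probability.LatticeModels
open Summit.HubbardSuperconductivity.HubbardSuperconductivity.Theorems.KLProgrammeLegKernels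

/-- **`(Λ/8)² ≤ (k₀+q₀)² + (e+σ)²`** whenever `(Λ/2)² < k₀² + e²`, `|q₀| ≤ Λ/8`, `|σ| ≤ Λ/6` (`Λ ≥ 0`) — the WIDE-shift form of `klfp_sq_ge`. -/
theorem klfp_sq_ge_sixth {Λ k₀ e q₀ σ : ℝ} (hΛ : 0 ≤ Λ) (hs : (Λ / 2) ^ 2 < k₀ ^ 2 + e ^ 2) (hq : |q₀| ≤ Λ / 8) (hσ : |σ| ≤ Λ / 6) :
    (Λ / 8) ^ 2 ≤ (k₀ + q₀) ^ 2 + (e + σ) ^ 2 := by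
  have hq' := abs_le.mp hq
  have hσ' := abs_le.mp hσ
  rcases le_or_gt (7 * Λ / 24) |e| with he | he
  · -- `|e| ≥ 7Λ/24`: then `|e + σ| ≥ 7Λ/24 − Λ/6 = Λ/8`
    have h1 : Λ / 8 ≤ |e + σ| := by
      have := abs_sub_abs_le_abs_sub e (-σ)
      rw [abs_neg, sub_neg_eq_add] at this
      linarith
    have h2 : (Λ / 8) ^ 2 ≤ (e + σ) ^ 2 := by
      rw [← sq_abs (e + σ)]; exact pow_le_pow_left₀ (by positivity) h1 2
    nlinarith [sq_nonneg (k₀ + q₀)]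
  · -- `|e| < 7Λ/24`: then `k₀² > Λ²/4 − 49Λ²/576 > Λ²/16`, so `|k₀| > Λ/4` and `|k₀ + q₀| ≥ |k₀| − Λ/8 ≥ Λ/8`
    have he2 : e ^ 2 < (7 * Λ / 24) ^ 2 := by
      rw [← sq_abs e]; exact pow_lt_pow_left₀ he (abs_nonneg e) two_ne_zero
    have hk2 : (Λ / 4) ^ 2 < k₀ ^ 2 := by nlinarith
    have hk : Λ / 4 ≤ |k₀| := by
      by_contra hlt
      push Not at hlt
      have : k₀ ^ 2 < (Λ / 4) ^ 2 := by rw [← sq_abs k₀]; exact pow_lt_pow_left₀ hlt (abs_nonneg _) two_ne_zero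
      linarith
    have h1 : Λ / 8 ≤ |k₀ + q₀| := by
      have := abs_sub_abs_le_abs_sub k₀ (-q₀)
      rw [abs_neg, sub_neg_eq_add] at this
      linarith
    have h2 : (Λ / 8) ^ 2 ≤ (k₀ + q₀) ^ 2 := by
      rw [← sq_abs (k₀ + q₀)]; exact pow_le_pow_left₀ (by positivity) h1 2
    nlinarith [sq_nonneg (e + σ)]

/-- (WIDE energy shift `Λ_n/6`.) **Cutting the second weight below `(Λ_n/16)²` does not change the lattice summand** (first line on the slice, `|q₀| ≤ Λ_n/8`,
`|ẽ'(p) − ẽ(p)| ≤ Λ_n/6`). -/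
theorem klfl_summand_cut_eq_sixth {a : ℝ × ℝ → ℂ} {eb eb' : ℝ × ℝ → ℝ} {f f' : ℝ → ℂ} {n : ℕ}
    (hin : ∀ s, s ≤ (klScale klE0 n / 2) ^ 2 → f s = 0) {k₀ q₀ : ℝ} (hq₀ : |q₀| ≤ klScale klE0 n / 8) {p : ℝ × ℝ}
    (hσ : |eb' p - eb p| ≤ klScale klE0 n / 6) :
    a p * klfb_prop f k₀ (eb p) * klfb_prop f' (k₀ + q₀) (eb' p) =
      a p * klfb_prop f k₀ (eb p) * klfb_prop (fun s => f' s * (klfp_cut (klScale klE0 n) s : ℂ)) (k₀ + q₀) (eb' p) := by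
  have hΛ := klth_klScale_pos n
  by_cases hs : k₀ ^ 2 + eb p ^ 2 ≤ (klScale klE0 n / 2) ^ 2
  · simp only [klfb_prop, hin _ hs, zero_div, zero_mul, mul_zero]
  · have hs' := klfp_sq_ge_sixth hΛ.le (not_le.mp hs) hq₀ hσ
    rw [add_sub_cancel] at hs'
    simp only [klfb_prop, klfp_cutWeight_eq hΛ.ne' hs']

end Summit.HubbardSuperconductivity.HubbardSuperconductivity.Theorems.KLRegimeSplit

end
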